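import Literature.MathematicalPhysics.QuantumFieldTheory.CubicalChainsPoincareOneCoeff
import Literature.MathematicalPhysics.QuantumFieldTheory.CubicalStarFour
import HarnessLib

/-!
# Closed 3-cochains in a box of `ℤ⁴` with coefficients in an abelian group are coboundaries of
# 2-cochains near the box

Coefficient generalisation of the end of `CubicalChainsPoincareOne.lean` (closed 1-chains in a
box are boundaries of 2-chains in the box) and of `CubicalStarFour.lean` (the lattice Hodge star
on `ℤ⁴` and Fröhlich–Spencer's Lemma 1 in cochain degree three), from `ℤ`-valued to `A`-valued
(co)chains for an arbitrary additive commutative group `A` — e.g. a finite abelian group of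
't Hooft fluxes / centre-valued monopole currents — WITHOUT the `ℓ¹ → ℓ^∞` bound of the integer
statements (meaningless for general `A`); the sweep with coefficients is
`CubicalChainsPoincareOneCoeff.lean`. Since `A` may have `2`-torsion, "alternating" is carried as
the pair of conditions `M y j i = -M y i j`, `M y i i = 0` (the shape of `LatticeForm.IsAlt`).

* `LatticeChain.exists_div₂_eq_of_div₁_eq_zero` (**closed `A`-valued 1-chains in a box of `ℤ^d`
  are boundaries of alternating 2-chains in the box**), by induction over the directions carried
  by the chain (`Coeff.exists_div₂_eq_aux`).
* `LatticeChain.Coeff.star₃ / star₂` (the stars of `CubicalStarFour` with coefficients, signs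
  acting by `ℤ`-scalar multiplication), `Coeff.div₁_star₃` (`⋆d = ∂⋆` in the top degree),
  `Coeff.div₂_star₂` (middle degree), `Coeff.star₂_star₂` (`⋆⋆ = 1`).
* `LatticeChain.exists_d₂_eq_of_cd₃_apply_eq_zero_coeff` (**an `A`-valued 3-cochain on `ℤ⁴`,
  closed on the increasing 4-cells and supported in the box `[a, b]`, is `d₂ ω` on the increasing
  triples for an alternating `A`-valued 2-cochain `ω` supported in `[a - 2, b + 1]`**) — the
  compact-support Poincaré lemma in degree three with arbitrary coefficients (local fillings of
  small closed centre-valued monopole currents).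

Everything is proved; no named fact is introduced.

## References

* J. Fröhlich, T. Spencer, Comm. Math. Phys. 83 (1982) 411–454, §2.3 (2.17)–(2.18) (the lattice
  Hodge star), Lemma 1 (p. 421: Poincaré lemma with supports, forms with values in `K`), (2.56).
  [FrohlichSpencerCMP1982]
-/

noncomputable section

open Finset Function Literature.Probability.LatticeModels

namespace Literature.MathematicalPhysics.QuantumFieldTheory

namespace LatticeChain

open LatticeForm (e d₂)

variable {d : ℕ} {A : Type*} [AddCommGroup A]

namespace Coeff

/-! ### Closed 1-chains in a box are boundaries of 2-chains in the box, coefficients in `A` -/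

/-- Induction over the set of directions carried by the chain. [folklore] -/
theorem exists_div₂_eq_aux (a b : Site d) (S : Finset (Fin d)) :
    ∀ ρ : Site d → Fin d → A, div₁ ρ = 0 →
      (∀ y k, ρ y k ≠ 0 → a ≤ y ∧ y + e k ≤ b) → (∀ y k, ρ y k ≠ 0 → k ∈ S) →
        ∃ M : Site d → Fin d → Fin d → A, (∀ y i j, M y j i = -M y i j) ∧ (∀ y i, M y i i = 0) ∧
          div₂ M = ρ ∧ ∀ y j k, M y j k ≠ 0 → a ≤ y ∧ y + e j + e k ≤ b := by
  classical
  induction S using Finset.induction_on with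
  | empty =>
    intro ρ _ _ hS
    have hρ : ρ = 0 := by
      funext y k
      by_contra hne
      exact Finset.notMem_empty k (hS y k hne)
    refine ⟨0, fun _ _ _ => by simp, fun _ _ => by simp, ?_, fun y j k h => absurd rfl h⟩
    rw [div₂_zero, hρ]
  | insert ℓ S hℓS ih =>
    intro ρ hcl hsupp hS
    have hdec := eq_div₂_sweepH₁_add_sweepπ₁ (ℓ := ℓ) hcl hsupp
    have hcl' := div₁_sweepπ₁ (ℓ := ℓ) hcl hsupp
    obtain ⟨-, hHsupp, hπsupp⟩ := sweep_supports₁ (a := a) (b := b) (ℓ := ℓ) hsupp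
    have hS' : ∀ y k, sweepπ₁ a b ℓ ρ y k ≠ 0 → k ∈ S := by
      intro y k h
      obtain ⟨hkℓ, -, s, -, hne⟩ := sweepπ₁_ne_zero_dir h
      exact (Finset.mem_insert.1 (hS _ k hne)).resolve_left hkℓ
    obtain ⟨M', hM'anti, hM'diag, hM'bd, hM'supp⟩ := ih (sweepπ₁ a b ℓ ρ) hcl' hπsupp hS'
    refine ⟨sweepH₁ a b ℓ ρ + M', ?_, ?_, ?_, ?_⟩
    · intro y i j
      simp only [Pi.add_apply]
      rw [sweepH₁_swap, hM'anti y i j]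
      abel
    · intro y i
      simp only [Pi.add_apply]
      rw [sweepH₁_diag, hM'diag, add_zero]
    · rw [div₂_add, hM'bd, ← hdec]
    · intro y j k h
      simp only [Pi.add_apply] at h
      by_cases hH : sweepH₁ a b ℓ ρ y j k = 0
      · rw [hH, zero_add] at h
        exact hM'supp y j k h
      · exact hHsupp y j k hH

end Coeff

/-- **Closed 1-chains in a box are boundaries of 2-chains in the box, with coefficients in an
abelian group** (Fröhlich–Spencer 1982 Lemma 1 in degree one for `K`-valued forms, chain language
of `ℤ^d`, without the sup bound): an `A`-valued 1-chain `ρ` with `div₁ ρ = 0` all of whose links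
`(y, k)` lie in the box `[a, b]` (`a ≤ y`, `y + e_k ≤ b`) is `div₂ M` for an `A`-valued 2-chain
`M`, antisymmetric with zero diagonal, all of whose plaquettes lie in the same box. Proof: sweep
the coordinate directions in turn (`Coeff.eq_div₂_sweepH₁_add_sweepπ₁`).
[cite: FrohlichSpencerCMP1982, §2.3 Lemma 1 p. 421 (Poincaré lemma with supports), (2.56)] -/
theorem exists_div₂_eq_of_div₁_eq_zero (a b : Site d) (ρ : Site d → Fin d → A) (hcl : div₁ ρ = 0)
    (hsupp : ∀ y k, ρ y k ≠ 0 → a ≤ y ∧ y + e k ≤ b) :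
    ∃ M : Site d → Fin d → Fin d → A, (∀ y i j, M y j i = -M y i j) ∧ (∀ y i, M y i i = 0) ∧
      div₂ M = ρ ∧ ∀ y j k, M y j k ≠ 0 → a ≤ y ∧ y + e j + e k ≤ b :=
  Coeff.exists_div₂_eq_aux a b Finset.univ ρ hcl hsupp fun _ k _ => Finset.mem_univ k

/-! ### The stars with coefficients and Lemma 1 in cochain degree three on `ℤ⁴` -/

namespace Coeff

/-- **The star of an `A`-valued 3-cochain on `ℤ⁴`**: the 1-chain `(⋆Q)(y, l) = (-1)^l Q(-y; ĉ_l)`.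
[cite: FrohlichSpencerCMP1982, §2.3 (2.17)] -/
def star₃ (Q : Site 4 → Fin 4 → Fin 4 → Fin 4 → A) : Site 4 → Fin 4 → A :=
  fun y l => sgn₃ l • Q (-y) (compl₃ l).1 (compl₃ l).2.1 (compl₃ l).2.2

/-- **The star of an `A`-valued 2-cochain on `ℤ⁴`**: the 2-chain `(⋆ω)(y; j, k) = t_{jk} ω(-y; ĉ_{jk})`.
[cite: FrohlichSpencerCMP1982, §2.3 (2.17)] -/
def star₂ (ω : Site 4 → Fin 4 → Fin 4 → A) : Site 4 → Fin 4 → Fin 4 → A :=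
  fun y j k => sgn₂ j k • ω (-y) (compl₂ j k).1 (compl₂ j k).2

/-- `⋆ω` is antisymmetric. [folklore] -/
theorem star₂_swap (ω : Site 4 → Fin 4 → Fin 4 → A) (y : Site 4) (i j : Fin 4) :
    star₂ ω y j i = -star₂ ω y i j := by
  simp only [star₂]
  fin_cases i <;> fin_cases j <;> simp [sgn₂, compl₂]

/-- `⋆ω` has zero diagonal. [folklore] -/
theorem star₂_diag (ω : Site 4 → Fin 4 → Fin 4 → A) (y : Site 4) (i : Fin 4) : star₂ ω y i i = 0 := by
  simp only [star₂]
  fin_cases i <;> simp [sgn₂]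

/-- **`⋆d = ∂⋆` in the top degree**, coefficients in `A`: `∂(⋆Q)(y) = (dQ)(-y; 0, 1, 2, 3)`.
[cite: FrohlichSpencerCMP1982, §2.3 (2.18)] -/
theorem div₁_star₃ (Q : Site 4 → Fin 4 → Fin 4 → Fin 4 → A) (y : Site 4) :
    div₁ (star₃ Q) y = cd₃ Q (-y) 0 1 2 3 := by
  simp only [div₁, star₃, cd₃, Fin.sum_univ_four, neg_sub', sub_neg_eq_add]
  simp [sgn₃, compl₃]
  abel

/-- **`⋆d = ∂⋆` in the middle degree**, coefficients in `A`: `∂(⋆ω) = ⋆(dω)`.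
[cite: FrohlichSpencerCMP1982, §2.3 (2.18)] -/
theorem div₂_star₂ (ω : Site 4 → Fin 4 → Fin 4 → A) : div₂ (star₂ ω) = star₃ (d₂ ω) := by
  funext y k
  simp only [div₂, star₂, star₃, LatticeForm.d₂, Fin.sum_univ_four, neg_sub', sub_neg_eq_add]
  fin_cases k <;> simp [sgn₂, sgn₃, compl₂, compl₃] <;> abel

/-- **`⋆⋆ = 1`** on antisymmetric 2-chains with zero diagonal, coefficients in `A`. [folklore] -/
theorem star₂_star₂ (M : Site 4 → Fin 4 → Fin 4 → A) (hanti : ∀ y i j, M y j i = -M y i j)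
    (hdiag : ∀ y i, M y i i = 0) : star₂ (star₂ M) = M := by
  funext y j k
  simp only [star₂, neg_neg]
  fin_cases j <;> fin_cases k <;>
    simp [sgn₂, compl₂, hanti y 0 1, hanti y 0 2, hanti y 0 3, hanti y 1 2, hanti y 1 3,
      hanti y 2 3, hdiag]

/-- The components of an `A`-valued 3-cochain on the increasing triples determine its star and
conversely. [folklore] -/
theorem apply_compl₃_eq_smul_star₃ (Q : Site 4 → Fin 4 → Fin 4 → Fin 4 → A) (x : Site 4)
    (l : Fin 4) :
    Q x (compl₃ l).1 (compl₃ l).2.1 (compl₃ l).2.2 = sgn₃ l • star₃ Q (-x) l := by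
  simp only [star₃, neg_neg, smul_smul]
  fin_cases l <;> simp [sgn₃]

end Coeff

/-- **Closed `A`-valued 3-cochains in a box of `ℤ⁴` are coboundaries of 2-cochains near the box**
(Fröhlich–Spencer 1982 Lemma 1 in cochain degree three, for forms with values in an arbitrary
abelian group `A`, through the lattice Hodge star; no sup bound). Let `Q` be an `A`-valued
3-cochain on `ℤ⁴`, closed on the increasing 4-cells (`cd₃ Q (x; 0, 1, 2, 3) = 0` for all `x`),
whose non-zero increasing-triple components `Q(x; ĉ_l)` have `a ≤ x ≤ b`. Then there is an
`A`-valued 2-cochain `ω`, antisymmetric with zero diagonal, with `(d₂ ω)(x; ĉ_l) = Q(x; ĉ_l)` for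
all `x, l`, supported on `a - 2 ≤ x ≤ b + 1`. (The compact-support Poincaré lemma in degree three
with finite coefficients: local fillings of small closed centre-valued monopole currents.)
[cite: FrohlichSpencerCMP1982, §2.3 Lemma 1 p. 421 with (2.17)–(2.18); (2.56)] -/
theorem exists_d₂_eq_of_cd₃_apply_eq_zero_coeff (a b : Site 4)
    (Q : Site 4 → Fin 4 → Fin 4 → Fin 4 → A) (hcl : ∀ x, cd₃ Q x 0 1 2 3 = 0)
    (hsupp : ∀ x l, Q x (compl₃ l).1 (compl₃ l).2.1 (compl₃ l).2.2 ≠ 0 → a ≤ x ∧ x ≤ b) :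
    ∃ ω : Site 4 → Fin 4 → Fin 4 → A, (∀ x i j, ω x j i = -ω x i j) ∧ (∀ x i, ω x i i = 0) ∧
      (∀ x l, d₂ ω x (compl₃ l).1 (compl₃ l).2.1 (compl₃ l).2.2 =
        Q x (compl₃ l).1 (compl₃ l).2.1 (compl₃ l).2.2) ∧
      ∀ x i j, ω x i j ≠ 0 → a - 2 ≤ x ∧ x ≤ b + 1 := by
  set ρ := Coeff.star₃ Q with hρ
  -- `ρ` is a closed 1-chain in the reflected box
  have hclρ : div₁ ρ = 0 := by
    funext y
    rw [hρ, Coeff.div₁_star₃, hcl (-y)]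
    rfl
  have hρval : ∀ y l, ρ y l ≠ 0 → Q (-y) (compl₃ l).1 (compl₃ l).2.1 (compl₃ l).2.2 ≠ 0 := by
    intro y l h hQ
    exact h (by rw [hρ, Coeff.star₃, hQ, smul_zero])
  have hsuppρ : ∀ y l, ρ y l ≠ 0 → -b ≤ y ∧ y + e l ≤ -a + 1 := by
    intro y l h
    obtain ⟨ha, hb⟩ := hsupp (-y) l (hρval y l h)
    refine ⟨by intro m; have := hb m; simp only [Pi.neg_apply] at this ⊢; omega, fun m => ?_⟩
    have := ha m
    simp only [Pi.add_apply, Pi.neg_apply, Pi.one_apply, LatticeForm.e, Pi.single_apply] at this ⊢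
    split_ifs <;> omega
  obtain ⟨M, hManti, hMdiag, hMbd, hMsupp⟩ :=
    exists_div₂_eq_of_div₁_eq_zero (-b) (-a + 1) ρ hclρ hsuppρ
  refine ⟨Coeff.star₂ M, Coeff.star₂_swap M, Coeff.star₂_diag M, ?_, ?_⟩
  · -- `d₂ (⋆M) = Q` on increasing triples: `⋆(d₂ ⋆M) = ∂(⋆⋆M) = ∂M = ρ = ⋆Q`
    intro x l
    have key : Coeff.star₃ (d₂ (Coeff.star₂ M)) = Coeff.star₃ Q := by
      rw [← Coeff.div₂_star₂, Coeff.star₂_star₂ M hManti hMdiag, hMbd]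
    have := congrFun (congrFun key (-x)) l
    rw [Coeff.apply_compl₃_eq_smul_star₃ (d₂ (Coeff.star₂ M)),
      Coeff.apply_compl₃_eq_smul_star₃ Q, this]
  · -- support
    intro x i j h
    have hne : M (-x) (compl₂ i j).1 (compl₂ i j).2 ≠ 0 := by
      intro h0
      exact h (by rw [Coeff.star₂, h0, smul_zero])
    obtain ⟨h1, h2⟩ := hMsupp _ _ _ hne
    refine ⟨fun m => ?_, fun m => ?_⟩
    · have := h2 m
      simp only [Pi.add_apply, Pi.neg_apply, LatticeForm.e, Pi.single_apply,
        Pi.sub_apply, Pi.ofNat_apply] at this ⊢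
      split_ifs at this <;> omega
    · have := h1 m
      simp only [Pi.neg_apply, Pi.add_apply, Pi.one_apply] at this ⊢
      omega

end LatticeChain

end Literature.MathematicalPhysics.QuantumFieldTheory
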